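import Mathlib.LinearAlgebra.Prod
import Mathlib.Algebra.Module.Submodule.Ker
import Mathlib.Algebra.Module.Submodule.Range
import Mathlib.Tactic.LinearCombination
import Mathlib.Tactic.Module
import Mathlib.Tactic.Abel
import HarnessLib

/-!
# THE `p`-OLD PART IS CUT OUT BY ITS QUADRATIC: Proposition V64-B case (B1) (`a_p(ρ̄) ≢ ±(p+1)`, e.g. `a₃(ρ̄) = 0`) in the kernel WITHOUT the "no `p`-new form at a non-ordinary `𝔪`" input — `ker(U² − tU + p) = j′(K × K)`, the `p`-old projector is a polynomial in `U_p`, and `Y = j′(K × K) ⊕ ker(U² − 1)` (cell `b2b-bsdres`, seat additive-p4 gen 39, line V68 — K118c)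

HONEST FRAMING (verbatim, cell `b2b-bsdres`): the goal of the cell is to DELETE the COMBINATION-SHAPED
residual classes for ALL analytic-rank `≤ 1` curves over `ℚ` — "full BSD formula for every rank `≤ 1`
curve in class `C`" assembled STRICTLY from published theorems — so that the rank-`≤ 1` remainder
becomes exactly the CONSTRUCTION-SHAPED classes, which are TYPED (missing-input Props), NOT attempted;
this is not "finishing BSD". This file: TOOL theorems (pure module algebra; 0 defs, 0 facts, nothing
booked; X4 stays CONSTRUCTION-shaped).

## What is proved

Setting of `X4/UpNilpotentPartOfSemistableLevel.lean` (K114) and `X4/UpNilpotentProjector.lean` (K118a):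
`R` a commutative ring (`𝕋(M)_𝔪`), `K = H_{M,𝔪}`, `Y = H_{pM,𝔪}`, `j′ = d₁.coprod dₚ : K × K → Y` the
`p`-old pair, `U = U_p` on `Y` with convention (A) `U (d₁ x) = d₁ (t • x) − p • dₚ x`, `U (dₚ x) = d₁ x`
(`t = T_p`), and `hAL : U (U y) − y ∈ range j′` (`U_p = ∓W_p` on `p`-new forms). Memo V64 §3 treats the
case `T_p ∈ 𝔪` (B1) by a Galois-theoretic input (B0) "no `p`-new form at a non-ordinary `𝔪`"
(Fontaine/Edixhoven). Here that input is REMOVED: whenever `t² − (p+1)²` is a unit of `R` — i.e.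
`a_p(ρ̄) ≢ ±(p+1) (mod 𝔪)`, the NON-level-raising condition at `p`; at `p = 3` exactly `a₃(ρ̄) = 0`, the
rows T3/T4/T5 of the θ-class —

* `quadratic_apply_sq_sub_one` — `(U² − tU + p)((U² − 1) y) = 0`: the quartic `(X² − tX + p)(X² − 1)`
  annihilates `U` on `Y` (from `hAL`);
* `ker_quadratic_le_range_coprod` — **`ker(U² − tU + p) ≤ range j′`** by a UNIT argument:
  `(t² − (p+1)²) • y = (tU + (p+1))((U² − 1) y) − t² • (U² − 1) y ∈ range j′`;
* `range_coprod_eq_ker_quadratic` — **the `p`-old part IS `ker(U² − tU + p)`**;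
* `oldProjector_*` — for `d` with `d · (t² − (p+1)²) = 1`, the endomorphism
  **`e₁ := d • ((t • U + ((p+1) − t²) • 1) ∘ (U² − 1))`** (Bezout: `a·(X² − tX + p) + b·(X² − 1) = 1` with
  `b = d(tX + (p+1) − t²)`, `a = −d(tX + (p+1))`) maps into `ker(U² − tU + p)` and `U² − 1` kills
  `y − e₁ y`;
* `isCompl_ker_quadratic_ker_sq_sub_one` — **`Y = ker(U² − tU + p) ⊕ ker(U² − 1)`** = (`p`-old part)
  ⊕ (the `p`-new vectors at `𝔪`, on which `U = ±1`): T-V54 at `(pM, 𝔪)` is the conjunction of T-V54 on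
  `j′(K × K)` and T-V54 on `ker(U² − 1)` (the latter VACUOUS when there is no `p`-new vector at `𝔪` —
  E15: `p`-new rank 0 on 16695h1/18018v1/19530bk1 — but no longer an input of the splitting);
* `smul_mem_imp_iff_prod_map_of_injective` — the two-copy saturation transfer: `S ≤ K` is `r`-saturated
  iff `j′(S × S)` is `r`-saturated in `range j′` (`j′` injective = Ihara at `p ∤ M`, BY NAME in the
  application) — T-V54 @ `(pM, 𝔪, p-old)` ⟺ T-V54 @ `(M, 𝔪)` once the old lattices are identified
  (`O_{ℓ_i}(Y) ∩ j′(K²) = j′(O_{ℓ_i}(K)²)`: degeneracies at `ℓ_i` and `p` commute — displayed, as in K114);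
* `pOldPart_caseB1` — the four statements assembled.

Together with K114/K115/K118a/b (case (B2), `a_p(ρ̄)` a unit ≠ … i.e. `T_p ∉ 𝔪`) this puts Proposition
V64-B in the kernel on ALL SIX θ-rows with displayed inputs = convention (A), `hAL`, Ihara at `p ∤ M`,
and ONE unit hypothesis (`t² − (p+1)² ∈ R^×` here; the Hensel roots with `u₁ − u₀`, `u₀² − 1 ∈ R^×` there).

## References (context only; the proofs are elementary)

* A. Wiles, Ann. of Math. 141 (1995), §2 (the `p`-old pair and `U_p`). [cite: Wiles1995, §2]
* K. Ribet, Proc. ICM 1983 (1984), Thm. 4.1 (Ihara's lemma, BY NAME). [cite: Ribet1984ICM, Thm. 4.1]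
* K. Ribet, Invent. Math. 100 (1990), Remark 3.9 / (3.19) (the companion endomorphism of the `q`-old pair). [cite: Ribet1990, Remark 3.9]
-/

namespace Summit.BirchSwinnertonDyer.Rank1Residual.LevelLowering

section CaseB1

variable {R K Y : Type*} [CommRing R] [AddCommGroup K] [Module R K] [AddCommGroup Y] [Module R Y]

/-- **The quartic `(X² − tX + p)(X² − 1)` annihilates `U` on `Y`**: `(U² − 1) y ∈ range j′` by `hAL`, and
the quadratic kills `range j′`. [cite: Wiles1995, §2] -/
theorem quadratic_apply_sq_sub_one (t p : R) (d₁ dₚ : K →ₗ[R] Y) (U : Y →ₗ[R] Y)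
    (hU₁ : ∀ x, U (d₁ x) = d₁ (t • x) - p • dₚ x) (hUₚ : ∀ x, U (dₚ x) = d₁ x)
    (hAL : ∀ y, U (U y) - y ∈ LinearMap.range (d₁.coprod dₚ)) (y : Y) :
    U (U (U (U y) - y)) = t • U (U (U y) - y) - p • (U (U y) - y) := by
  obtain ⟨w, hw⟩ := hAL y
  rw [← hw]
  -- the quadratic relation on the `p`-old pair (K118a `quadratic_apply_coprod`, recomputed inline so that
  -- this file does not wait for the farm's build of its siblings)
  obtain ⟨x, x'⟩ := w
  simp only [LinearMap.coprod_apply, map_add, map_sub, map_smul, hU₁, hUₚ]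
  module

/-- **`ker(U² − tU + p) ≤ range j′` by a UNIT argument** (`t² − (p+1)²` a unit, i.e. `a_p(ρ̄) ≢ ±(p+1)`):
for `y` with `U² y = tUy − py`, `(U² − 1) y = tUy − (p+1)y ∈ range j′` and
`(t² − (p+1)²) • y = (tU + (p+1))((U² − 1) y) − t² • ((U² − 1) y) ∈ range j′`. No Galois-theoretic
input ("no `p`-new form at a non-ordinary `𝔪`") is used. [cite: Wiles1995, §2] -/
theorem ker_quadratic_le_range_coprod (t p d : R) (hd : d * (t * t - (p + 1) * (p + 1)) = 1)
    (d₁ dₚ : K →ₗ[R] Y) (U : Y →ₗ[R] Y)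
    (hU₁ : ∀ x, U (d₁ x) = d₁ (t • x) - p • dₚ x) (hUₚ : ∀ x, U (dₚ x) = d₁ x)
    (hAL : ∀ y, U (U y) - y ∈ LinearMap.range (d₁.coprod dₚ))
    (y : Y) (hy : U (U y) = t • U y - p • y) : y ∈ LinearMap.range (d₁.coprod dₚ) := by
  set P : Submodule R Y := LinearMap.range (d₁.coprod dₚ) with hP
  have hUP : ∀ z ∈ P, U z ∈ P := by
    -- `U (j′ (x, x')) = j′ (t • x + x', −(p • x))` (K114's `pOldPair_coprod_apply`, inline)
    rintro z ⟨⟨x, x'⟩, rfl⟩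
    refine ⟨(t • x + x', -(p • x)), ?_⟩
    simp only [LinearMap.coprod_apply, map_add, hU₁, hUₚ, map_neg, map_smul]
    abel
  have hg : U (U y) - y ∈ P := hAL y
  -- the combination (tU + (p+1))(g y) − t² • (g y) equals (t² − (p+1)²) • y
  have hcomb : t • U (U (U y) - y) + (p + 1) • (U (U y) - y) - (t * t) • (U (U y) - y)
      = (t * t - (p + 1) * (p + 1)) • y := by
    rw [map_sub, hy, map_sub, map_smul, map_smul, hy]
    module
  have hmem : (t * t - (p + 1) * (p + 1)) • y ∈ P := by
    rw [← hcomb]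
    exact P.sub_mem (P.add_mem (P.smul_mem t (hUP _ hg)) (P.smul_mem _ hg)) (P.smul_mem _ hg)
  have : y = d • (t * t - (p + 1) * (p + 1)) • y := by rw [smul_smul, hd, one_smul]
  rw [this]
  exact P.smul_mem d hmem

/-- **THE `p`-OLD PART IS `ker(U² − tU + p)`** (`t² − (p+1)²` a unit). [cite: Wiles1995, §2] -/
theorem range_coprod_eq_ker_quadratic (t p d : R) (hd : d * (t * t - (p + 1) * (p + 1)) = 1)
    (d₁ dₚ : K →ₗ[R] Y) (U : Y →ₗ[R] Y)
    (hU₁ : ∀ x, U (d₁ x) = d₁ (t • x) - p • dₚ x) (hUₚ : ∀ x, U (dₚ x) = d₁ x)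
    (hAL : ∀ y, U (U y) - y ∈ LinearMap.range (d₁.coprod dₚ)) :
    LinearMap.range (d₁.coprod dₚ) = LinearMap.ker (U * U - t • U + p • 1) := by
  have hmem : ∀ y, y ∈ LinearMap.ker (U * U - t • U + p • (1 : Module.End R Y)) ↔
      U (U y) = t • U y - p • y := by
    intro y
    simp only [LinearMap.mem_ker, LinearMap.add_apply, LinearMap.sub_apply, Module.End.mul_apply,
      LinearMap.smul_apply, Module.End.one_apply]
    constructor
    · intro h; linear_combination (norm := module) h
    · intro h; rw [h]; module
  apply le_antisymm
  · rintro y ⟨⟨x, x'⟩, rfl⟩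
    refine (hmem _).mpr ?_
    simp only [LinearMap.coprod_apply, map_add, map_sub, map_smul, hU₁, hUₚ]
    module
  · intro y hy
    exact ker_quadratic_le_range_coprod t p d hd d₁ dₚ U hU₁ hUₚ hAL y ((hmem y).mp hy)

/-- The old projector `e₁ := d • (tU + ((p+1) − t²)) ∘ (U² − 1)` applied. -/
theorem oldProjector_apply (t p d : R) (U : Y →ₗ[R] Y) (y : Y) :
    (d • ((t • U + ((p + 1) - t * t) • 1) * (U * U - 1))) y
      = d • (t • U (U (U y) - y) + ((p + 1) - t * t) • (U (U y) - y)) := by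
  simp only [LinearMap.smul_apply, Module.End.mul_apply, LinearMap.add_apply, LinearMap.sub_apply,
    Module.End.one_apply]

/-- **`e₁` maps into the `p`-old part `ker(U² − tU + p)`**: with `z = (U² − 1) y` (a root vector of the
quadratic by `quadratic_apply_sq_sub_one`), `e₁ y = d • (tU + c) z` and the quadratic commutes with
`tU + c`. [cite: Wiles1995, §2] -/
theorem quadratic_apply_oldProjector (t p d : R) (d₁ dₚ : K →ₗ[R] Y) (U : Y →ₗ[R] Y)
    (hU₁ : ∀ x, U (d₁ x) = d₁ (t • x) - p • dₚ x) (hUₚ : ∀ x, U (dₚ x) = d₁ x)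
    (hAL : ∀ y, U (U y) - y ∈ LinearMap.range (d₁.coprod dₚ)) (y : Y) :
    U (U ((d • ((t • U + ((p + 1) - t * t) • 1) * (U * U - 1))) y))
      = t • U ((d • ((t • U + ((p + 1) - t * t) • 1) * (U * U - 1))) y)
        - p • (d • ((t • U + ((p + 1) - t * t) • 1) * (U * U - 1))) y := by
  have hz := quadratic_apply_sq_sub_one t p d₁ dₚ U hU₁ hUₚ hAL y
  -- abbreviate z := U (U y) - y; hz : U (U z) = t • U z - p • z
  rw [oldProjector_apply]
  set z : Y := U (U y) - y with hzdef
  simp only [map_add, map_smul, smul_add, smul_smul]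
  -- U (U (U z)) = t • U (U z) - p • U z
  have hz3 : U (U (U z)) = t • U (U z) - p • U z := by
    rw [show U (U (U z)) = U (t • U z - p • z) by rw [hz], map_sub, map_smul, map_smul]
  rw [hz3, hz]
  module

/-- **`U² − 1` kills `y − e₁ y`** (the Bezout identity `a·(X² − tX + p) + b·(X² − 1) = 1` evaluated at `U`
on the root vector `z = (U² − 1) y`: `(U² − 1)(e₁ y) = d (t² − (p+1)²) • z = z`). [cite: Wiles1995, §2] -/
theorem sq_sub_one_apply_sub_oldProjector (t p d : R) (hd : d * (t * t - (p + 1) * (p + 1)) = 1)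
    (d₁ dₚ : K →ₗ[R] Y) (U : Y →ₗ[R] Y)
    (hU₁ : ∀ x, U (d₁ x) = d₁ (t • x) - p • dₚ x) (hUₚ : ∀ x, U (dₚ x) = d₁ x)
    (hAL : ∀ y, U (U y) - y ∈ LinearMap.range (d₁.coprod dₚ)) (y : Y) :
    U (U (y - (d • ((t • U + ((p + 1) - t * t) • 1) * (U * U - 1))) y))
      - (y - (d • ((t • U + ((p + 1) - t * t) • 1) * (U * U - 1))) y) = 0 := by
  have hz := quadratic_apply_sq_sub_one t p d₁ dₚ U hU₁ hUₚ hAL y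
  rw [oldProjector_apply]
  set z : Y := U (U y) - y with hzdef
  have hz3 : U (U (U z)) = t • U (U z) - p • U z := by
    rw [show U (U (U z)) = U (t • U z - p • z) by rw [hz], map_sub, map_smul, map_smul]
  -- goal: (U² − 1)(y − e₁ y) = z − (U² − 1)(e₁ y) = z − d (t² − (p+1)²) • z = 0
  have key : U (U (d • (t • U z + ((p + 1) - t * t) • z))) - d • (t • U z + ((p + 1) - t * t) • z)
      = (d * (t * t - (p + 1) * (p + 1))) • z := by
    simp only [map_add, map_smul]
    rw [hz3, hz]
    module
  rw [hd, one_smul] at key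
  have e1 : U (U (y - d • (t • U z + ((p + 1) - t * t) • z)))
      - (y - d • (t • U z + ((p + 1) - t * t) • z))
      = (U (U y) - y) - (U (U (d • (t • U z + ((p + 1) - t * t) • z)))
          - d • (t • U z + ((p + 1) - t * t) • z)) := by
    simp only [map_sub]
    abel
  rw [e1, key, hzdef, sub_self]

/-- **`Y = ker(U² − tU + p) ⊕ ker(U² − 1)`** — (`p`-old part) ⊕ (`p`-new vectors at `𝔪`, `U = ±1` there),
when `t² − (p+1)²` is a unit: the splitting of memo V64 §3 in case (B1) WITHOUT the input (B0).
[cite: Wiles1995, §2] -/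
theorem isCompl_ker_quadratic_ker_sq_sub_one (t p d : R) (hd : d * (t * t - (p + 1) * (p + 1)) = 1)
    (d₁ dₚ : K →ₗ[R] Y) (U : Y →ₗ[R] Y)
    (hU₁ : ∀ x, U (d₁ x) = d₁ (t • x) - p • dₚ x) (hUₚ : ∀ x, U (dₚ x) = d₁ x)
    (hAL : ∀ y, U (U y) - y ∈ LinearMap.range (d₁.coprod dₚ)) :
    IsCompl (LinearMap.ker (U * U - t • U + p • 1)) (LinearMap.ker (U * U - 1)) := by
  have hmemf : ∀ y, y ∈ LinearMap.ker (U * U - t • U + p • (1 : Module.End R Y)) ↔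
      U (U y) = t • U y - p • y := by
    intro y
    simp only [LinearMap.mem_ker, LinearMap.add_apply, LinearMap.sub_apply, Module.End.mul_apply,
      LinearMap.smul_apply, Module.End.one_apply]
    constructor
    · intro h; linear_combination (norm := module) h
    · intro h; rw [h]; module
  have hmemg : ∀ y, y ∈ LinearMap.ker (U * U - (1 : Module.End R Y)) ↔ U (U y) - y = 0 := by
    intro y
    simp only [LinearMap.mem_ker, LinearMap.sub_apply, Module.End.mul_apply, Module.End.one_apply]
  refine IsCompl.of_eq ?_ ?_
  · rw [eq_bot_iff]
    rintro y ⟨hf, hg⟩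
    have hy : U (U y) = t • U y - p • y := (hmemf y).mp hf
    have hg0 : U (U y) - y = 0 := (hmemg y).mp hg
    -- (t² − (p+1)²) • y = (tU + (p+1))(g y) − t² • g y = 0
    have hcomb : t • U (U (U y) - y) + (p + 1) • (U (U y) - y) - (t * t) • (U (U y) - y)
        = (t * t - (p + 1) * (p + 1)) • y := by
      rw [map_sub, hy, map_sub, map_smul, map_smul, hy]
      module
    rw [hg0, map_zero, smul_zero, smul_zero, smul_zero, add_zero, sub_zero] at hcomb
    rw [Submodule.mem_bot]
    calc y = d • (t * t - (p + 1) * (p + 1)) • y := by rw [smul_smul, hd, one_smul]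
      _ = 0 := by rw [← hcomb, smul_zero]
  · rw [eq_top_iff]
    rintro y -
    refine Submodule.mem_sup.mpr ⟨(d • ((t • U + ((p + 1) - t * t) • 1) * (U * U - 1))) y, ?_,
      y - (d • ((t • U + ((p + 1) - t * t) • 1) * (U * U - 1))) y, ?_, add_sub_cancel _ _⟩
    · exact (hmemf _).mpr (quadratic_apply_oldProjector t p d d₁ dₚ U hU₁ hUₚ hAL y)
    · exact (hmemg _).mpr (sq_sub_one_apply_sub_oldProjector t p d hd d₁ dₚ U hU₁ hUₚ hAL y)

/-- **Two-copy saturation transfer**: for `j′` injective, `S ≤ K` is `r`-saturated in `K` iff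
`j′(S × S)` is `r`-saturated in `range j′` (T-V54 at `(pM, 𝔪, p-old)` ⟺ T-V54 at `(M, 𝔪)` once the old
lattices are identified with `j′(O_{ℓ_i}(K)²)`). [cite: Ribet1984ICM, Thm. 4.1] -/
theorem smul_mem_imp_iff_prod_map_of_injective (j : K × K →ₗ[R] Y) (hj : Function.Injective j) (r : R)
    (S : Submodule R K) :
    (∀ x : K, r • x ∈ S → x ∈ S) ↔
    (∀ w ∈ LinearMap.range j, r • w ∈ (S.prod S).map j → w ∈ (S.prod S).map j) := by
  constructor
  · rintro hsat w ⟨v, rfl⟩ hrw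
    obtain ⟨v', hv', hvv'⟩ := Submodule.mem_map.mp hrw
    have hv'eq : v' = r • v := hj (by rw [hvv', map_smul])
    rw [hv'eq] at hv'
    obtain ⟨h1, h2⟩ := Submodule.mem_prod.mp hv'
    exact Submodule.mem_map_of_mem (Submodule.mem_prod.mpr ⟨hsat _ h1, hsat _ h2⟩)
  · intro hsat x hx
    have h1 : r • j (x, 0) ∈ (S.prod S).map j := by
      rw [← map_smul]
      exact Submodule.mem_map_of_mem (Submodule.mem_prod.mpr ⟨by simpa using hx, by simp⟩)
    obtain ⟨v, hv, hvx⟩ := Submodule.mem_map.mp (hsat (j (x, 0)) (LinearMap.mem_range_self j _) h1)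
    have hveq : v = (x, 0) := hj hvx
    rw [hveq] at hv
    exact (Submodule.mem_prod.mp hv).1

/-- **PROPOSITION V64-B, CASE (B1), kernel form** (`t² − (p+1)²` a unit — `a_p(ρ̄) ≢ ±(p+1)`, at
`p = 3`: `a₃(ρ̄) = 0`): the `p`-old part `range j′` equals `ker(U² − tU + p)`; `Y` is the direct sum of it
and `ker(U² − 1)`; `j′` restricted is injective (Ihara, BY NAME in the application: hypothesis `hj`);
and `S ≤ K` is `r`-saturated iff `j′(S × S)` is `r`-saturated in the `p`-old part. Inputs: convention
(A), `hAL`, `hj`, the unit. NO Galois-theoretic input, NO finiteness. Research-route tool theorem;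
nothing booked. [cite: Wiles1995, §2] [cite: Ribet1984ICM, Thm. 4.1] -/
theorem pOldPart_caseB1 (t p d : R) (hd : d * (t * t - (p + 1) * (p + 1)) = 1)
    (d₁ dₚ : K →ₗ[R] Y) (U : Y →ₗ[R] Y)
    (hU₁ : ∀ x, U (d₁ x) = d₁ (t • x) - p • dₚ x) (hUₚ : ∀ x, U (dₚ x) = d₁ x)
    (hj : Function.Injective (d₁.coprod dₚ))
    (hAL : ∀ y, U (U y) - y ∈ LinearMap.range (d₁.coprod dₚ)) :
    LinearMap.range (d₁.coprod dₚ) = LinearMap.ker (U * U - t • U + p • 1)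
    ∧ IsCompl (LinearMap.ker (U * U - t • U + p • 1)) (LinearMap.ker (U * U - 1))
    ∧ (∀ w ∈ LinearMap.ker (U * U - t • U + p • 1), U w ∈ LinearMap.ker (U * U - t • U + p • 1))
    ∧ ∀ (r : R) (S : Submodule R K), ((∀ x : K, r • x ∈ S → x ∈ S) ↔
        (∀ w ∈ LinearMap.range (d₁.coprod dₚ), r • w ∈ (S.prod S).map (d₁.coprod dₚ) →
          w ∈ (S.prod S).map (d₁.coprod dₚ))) := by
  have hPeq := range_coprod_eq_ker_quadratic t p d hd d₁ dₚ U hU₁ hUₚ hAL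
  refine ⟨hPeq, isCompl_ker_quadratic_ker_sq_sub_one t p d hd d₁ dₚ U hU₁ hUₚ hAL, ?_,
    fun r S => smul_mem_imp_iff_prod_map_of_injective _ hj r S⟩
  intro w hw
  rw [← hPeq] at hw ⊢
  obtain ⟨⟨x, x'⟩, rfl⟩ := hw
  refine ⟨(t • x + x', -(p • x)), ?_⟩
  simp only [LinearMap.coprod_apply, map_add, hU₁, hUₚ, map_neg, map_smul]
  abel

end CaseB1

section Appendix

variable {R K Y : Type*} [CommRing R] [AddCommGroup K] [Module R K] [AddCommGroup Y] [Module R Y]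

/-! ### Appendix (gen 39, second landing): `e₁` is an idempotent with `Fix(e₁) = ker(U² − tU + p) = range j′`

These make the old projector a bona fide idempotent whose fixed submodule is the `p`-old part — exactly the
data `(e, N, hN)` that K115's `oldLattice_inf_nilpotentPart_eq` consumes (applied with the old projectors at
levels `pM` and `pM/ℓ_i`, which commute with the `ℓ_i`-degeneracies because they are polynomials in `U_p`). -/

/-- `e₁` commutes with `U` (it is a polynomial in `U`). -/
theorem oldProjector_comm (t p d : R) (U : Y →ₗ[R] Y) (y : Y) :
    (d • ((t • U + ((p + 1) - t * t) • 1) * (U * U - 1))) (U y)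
      = U ((d • ((t • U + ((p + 1) - t * t) • 1) * (U * U - 1))) y) := by
  rw [oldProjector_apply, oldProjector_apply]
  simp only [map_add, map_sub, map_smul]

/-- **`e₁ = 1` on the `p`-old part**: if `U² y = tUy − py` then `e₁ y = y` (the difference lies in
`ker(U² − tU + p) ⊓ ker(U² − 1) = ⊥`). [cite: Wiles1995, §2] -/
theorem oldProjector_apply_eq_self_of_quadratic (t p d : R) (hd : d * (t * t - (p + 1) * (p + 1)) = 1)
    (d₁ dₚ : K →ₗ[R] Y) (U : Y →ₗ[R] Y)
    (hU₁ : ∀ x, U (d₁ x) = d₁ (t • x) - p • dₚ x) (hUₚ : ∀ x, U (dₚ x) = d₁ x)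
    (hAL : ∀ y, U (U y) - y ∈ LinearMap.range (d₁.coprod dₚ))
    (y : Y) (hy : U (U y) = t • U y - p • y) :
    (d • ((t • U + ((p + 1) - t * t) • 1) * (U * U - 1))) y = y := by
  have hc := isCompl_ker_quadratic_ker_sq_sub_one t p d hd d₁ dₚ U hU₁ hUₚ hAL
  have hmemf : ∀ z, z ∈ LinearMap.ker (U * U - t • U + p • (1 : Module.End R Y)) ↔
      U (U z) = t • U z - p • z := by
    intro z
    simp only [LinearMap.mem_ker, LinearMap.add_apply, LinearMap.sub_apply, Module.End.mul_apply,
      LinearMap.smul_apply, Module.End.one_apply]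
    constructor
    · intro h; linear_combination (norm := module) h
    · intro h; rw [h]; module
  set e := (d • ((t • U + ((p + 1) - t * t) • 1) * (U * U - 1))) with he
  -- y − e y ∈ ker f ⊓ ker g = ⊥
  have h1 : y - e y ∈ LinearMap.ker (U * U - t • U + p • (1 : Module.End R Y)) := by
    refine Submodule.sub_mem _ ((hmemf y).mpr hy) ((hmemf _).mpr ?_)
    rw [he]
    exact quadratic_apply_oldProjector t p d d₁ dₚ U hU₁ hUₚ hAL y
  have h2 : y - e y ∈ LinearMap.ker (U * U - (1 : Module.End R Y)) := by
    simp only [LinearMap.mem_ker, LinearMap.sub_apply, Module.End.mul_apply, Module.End.one_apply]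
    rw [he]
    exact sq_sub_one_apply_sub_oldProjector t p d hd d₁ dₚ U hU₁ hUₚ hAL y
  have h3 : y - e y ∈ LinearMap.ker (U * U - t • U + p • (1 : Module.End R Y))
      ⊓ LinearMap.ker (U * U - (1 : Module.End R Y)) := ⟨h1, h2⟩
  rw [hc.inf_eq_bot, Submodule.mem_bot, sub_eq_zero] at h3
  exact h3.symm

/-- **`Fix(e₁) = ker(U² − tU + p)`** (`= range j′` by `range_coprod_eq_ker_quadratic`). [cite: Wiles1995, §2] -/
theorem oldProjector_apply_eq_self_iff (t p d : R) (hd : d * (t * t - (p + 1) * (p + 1)) = 1)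
    (d₁ dₚ : K →ₗ[R] Y) (U : Y →ₗ[R] Y)
    (hU₁ : ∀ x, U (d₁ x) = d₁ (t • x) - p • dₚ x) (hUₚ : ∀ x, U (dₚ x) = d₁ x)
    (hAL : ∀ y, U (U y) - y ∈ LinearMap.range (d₁.coprod dₚ)) (y : Y) :
    (d • ((t • U + ((p + 1) - t * t) • 1) * (U * U - 1))) y = y ↔ U (U y) = t • U y - p • y := by
  constructor
  · intro h
    rw [← h]
    exact quadratic_apply_oldProjector t p d d₁ dₚ U hU₁ hUₚ hAL y
  · exact oldProjector_apply_eq_self_of_quadratic t p d hd d₁ dₚ U hU₁ hUₚ hAL y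

/-- **`e₁` is an idempotent.** [cite: Wiles1995, §2] -/
theorem oldProjector_idem (t p d : R) (hd : d * (t * t - (p + 1) * (p + 1)) = 1)
    (d₁ dₚ : K →ₗ[R] Y) (U : Y →ₗ[R] Y)
    (hU₁ : ∀ x, U (d₁ x) = d₁ (t • x) - p • dₚ x) (hUₚ : ∀ x, U (dₚ x) = d₁ x)
    (hAL : ∀ y, U (U y) - y ∈ LinearMap.range (d₁.coprod dₚ)) (y : Y) :
    (d • ((t • U + ((p + 1) - t * t) • 1) * (U * U - 1)))
        ((d • ((t • U + ((p + 1) - t * t) • 1) * (U * U - 1))) y)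
      = (d • ((t • U + ((p + 1) - t * t) • 1) * (U * U - 1))) y :=
  oldProjector_apply_eq_self_of_quadratic t p d hd d₁ dₚ U hU₁ hUₚ hAL _
    (quadratic_apply_oldProjector t p d d₁ dₚ U hU₁ hUₚ hAL y)

end Appendix

end Summit.BirchSwinnertonDyer.Rank1Residual.LevelLowering
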